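import Literature.AlgebraicGeometry.Resolution.ExcellentRingsProofs
import Literature.AlgebraicGeometry.Resolution.SmoothUniformizationProofs
import Literature.AlgebraicGeometry.Resolution.AdicNoetherian
import Mathlib.RingTheory.LocalRing.ResidueField.Fiber
import HarnessLib

/-!
# Regular homomorphisms preserve and reflect regularity; the formal fibres of a local G-ring

Topic: `Literature/AlgebraicGeometry/Resolution`. For a regular homomorphism `A → B` of
Noetherian rings (`IsRegularHom`: flat with geometrically regular fibres, Matsumura §32;
`ExcellentRings.lean`) and a prime `𝔔` of `B` over `𝔭 = 𝔔 ∩ A`, the local ring `B_𝔔` is regular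
iff `A_𝔭` is (EGA IV₂ 6.5.1/6.5.2; Matsumura, Thm. 23.7 with the dimension formula 15.1), and
`dim A_𝔭 ≤ dim B_𝔔`. Applied to the completion `A → Â` of a Noetherian local G-ring `A`
(Matsumura §32, p. 256: the formal fibres of `A` are geometrically regular) this is
EGA IV₂ 7.8.3 (v): the regular locus of `Spec Â` is the inverse image of that of `Spec A`.

* `isRegularLocalRing_localization_comap_includeRight_iff` — the statement for a flat
  `A → B` whose fibre ring `κ(𝔭) ⊗_A B` over one prime `𝔭` is a regular ring, at a prime of
  that fibre ring (Mathlib's `Ideal.Fiber.localizationAlgEquivQuotient` identifies the local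
  rings of the fibre ring with the closed fibres `B_𝔔/𝔭B_𝔔`).
* `IsRegularHom.isRegularLocalRing_localization_iff`, `IsRegularHom.ringKrullDim_localization_le`.
* `IsGRing.isRegularHom_adicCompletion` — a Noetherian local G-ring has regular `A → Â`.
* `IsGRing.isRegularLocalRing_localization_adicCompletion_iff` — EGA IV₂ 7.8.3 (v) for a
  Noetherian local G-ring, prime by prime, with the dimension inequality.

## Sources

* A. Grothendieck, EGA IV₂ (Publ. Math. IHÉS 24, 1965), Prop. 6.5.1–6.5.2, Scholie 7.8.3 (v).
* H. Matsumura, *Commutative Ring Theory* (1986), Thm. 15.1, Thm. 23.7, §32 pp. 255–256.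
-/

noncomputable section

open IsLocalRing TensorProduct

namespace Literature.AlgebraicGeometry.Resolution

universe u

/-! ## Regularity along a flat homomorphism with regular fibre -/

section Fibre

variable {A B : Type u} [CommRing A] [CommRing B] [Algebra A B] [IsNoetherianRing A]
  [IsNoetherianRing B]

/-- **EGA IV₂ 6.5.1/6.5.2 at a prime of a regular fibre.** Let `A → B` be a flat homomorphism
of Noetherian rings and `𝔭` a prime of `A` whose fibre ring `κ(𝔭) ⊗_A B` is a regular ring. For
a prime `𝔮` of the fibre ring, with image `𝔔 = 𝔮 ∩ B` (a prime of `B` over `𝔭`), the local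
ring `B_𝔔` is regular iff `A_𝔭` is: `A_𝔭 → B_𝔔` is flat local with closed fibre
`B_𝔔/𝔭B_𝔔 ≅ (κ(𝔭) ⊗_A B)_𝔮` regular, so Matsumura's Thm. 23.7 (with the dimension formula,
`isRegularLocalRing_iff_of_flat_of_isRegularLocalRing_fibre`) applies.
[cite: Matsumura1987, Thm. 23.7] -/
theorem isRegularLocalRing_localization_comap_includeRight_iff [Module.Flat A B]
    (p : Ideal A) [p.IsPrime] (hF : IsRegularRing (p.Fiber B)) (q : Ideal (p.Fiber B))
    [q.IsPrime] :
    IsRegularLocalRing (Localization.AtPrime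
        (q.comap (Algebra.TensorProduct.includeRight : B →ₐ[A] p.Fiber B))) ↔
      IsRegularLocalRing (Localization.AtPrime p) := by
  set r : Ideal B := q.comap (Algebra.TensorProduct.includeRight : B →ₐ[A] p.Fiber B) with hr
  letI : Algebra (Localization.AtPrime p) (Localization.AtPrime r) :=
    Localization.AtPrime.algebraOfLiesOver p r
  set Ap := Localization.AtPrime p
  set Br := Localization.AtPrime r
  haveI : IsLocalHom (algebraMap Ap Br) := by
    rw [Localization.AtPrime.IsLiesOverAlgebra.algebraMap_eq (p := p) (P := r)]
    infer_instance
  -- flatness of `A_𝔭 → B_𝔔`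
  haveI : Module.Flat A Br := Module.Flat.trans A B Br
  haveI : Module.Flat Ap Br := (Module.flat_iff_of_isLocalization Ap p.primeCompl Br).mpr ‹_›
  -- the closed fibre `B_𝔔/𝔭B_𝔔 ≅ (κ(𝔭) ⊗_A B)_𝔮` is regular
  haveI : IsRegularLocalRing (Localization.AtPrime q) :=
    IsRegularRing.isRegularLocalRing_localization q
  let e := Ideal.Fiber.localizationAlgEquivQuotient p q
  have hpm : p.map (algebraMap A Br) = (maximalIdeal Ap).map (algebraMap Ap Br) := by
    rw [← Localization.AtPrime.map_eq_maximalIdeal, Ideal.map_map,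
      ← IsScalarTower.algebraMap_eq]
  haveI : IsRegularLocalRing (Br ⧸ (maximalIdeal Ap).map (algebraMap Ap Br)) :=
    IsRegularLocalRing.of_ringEquiv (R := Localization.AtPrime q)
      (e.toRingEquiv.trans (Ideal.quotEquivOfEq hpm))
  exact isRegularLocalRing_iff_of_flat_of_isRegularLocalRing_fibre (R := Ap) (S := Br)

/-- The dimension inequality `dim A_𝔭 ≤ dim B_𝔔` for a prime `𝔔` of `B` over `𝔭` along a flat
homomorphism of Noetherian rings (Matsumura, Thm. 15.1: `dim B_𝔔 = dim A_𝔭 + dim B_𝔔/𝔭B_𝔔`).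
[cite: Matsumura1987, Thm. 15.1] -/
theorem ringKrullDim_localization_under_le_of_flat [Module.Flat A B] (Q : Ideal B) [Q.IsPrime] :
    ringKrullDim (Localization.AtPrime (Q.under A)) ≤ ringKrullDim (Localization.AtPrime Q) := by
  set p : Ideal A := Q.under A with hp
  letI : Algebra (Localization.AtPrime p) (Localization.AtPrime Q) :=
    Localization.AtPrime.algebraOfLiesOver p Q
  set Ap := Localization.AtPrime p
  set BQ := Localization.AtPrime Q
  haveI : IsLocalHom (algebraMap Ap BQ) := by
    rw [Localization.AtPrime.IsLiesOverAlgebra.algebraMap_eq (p := p) (P := Q)]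
    infer_instance
  haveI : Module.Flat A BQ := Module.Flat.trans A B BQ
  haveI : Module.Flat Ap BQ := (Module.flat_iff_of_isLocalization Ap p.primeCompl BQ).mpr ‹_›
  rw [ringKrullDim_eq_add_of_flat (R := Ap) (S := BQ)]
  haveI : Nontrivial (BQ ⧸ (maximalIdeal Ap).map (algebraMap Ap BQ)) :=
    Ideal.Quotient.nontrivial_iff.mpr (map_maximalIdeal_ne_top (R := Ap) (S := BQ))
  exact le_add_of_nonneg_right ringKrullDim_nonneg_of_nontrivial

end Fibre

/-! ## Regular homomorphisms -/

namespace IsRegularHom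

variable {A B : Type u} [CommRing A] [CommRing B] [Algebra A B] [IsNoetherianRing A]
  [IsNoetherianRing B]

/-- **Regularity ascends and descends along a regular homomorphism** (EGA IV₂ 6.5.1 (descent,
flatness alone) and 6.5.2 (ii) (ascent for regular fibres); Matsumura, Thm. 23.7): for
`A → B` regular (flat with geometrically regular fibres) and a prime `𝔔` of `B` over
`𝔭 = 𝔔 ∩ A`, `B_𝔔` is a regular local ring iff `A_𝔭` is. [cite: Matsumura1987, Thm. 23.7] -/
theorem isRegularLocalRing_localization_iff (h : IsRegularHom A B) (Q : Ideal B) [Q.IsPrime] :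
    IsRegularLocalRing (Localization.AtPrime Q) ↔
      IsRegularLocalRing (Localization.AtPrime (Q.under A)) := by
  set p : Ideal A := Q.under A with hp
  haveI : Module.Flat A B := h.1
  -- the fibre ring over `𝔭` is regular (geometric regularity with `k' = κ(𝔭)`)
  have hF : IsRegularRing (p.Fiber B) := by
    haveI : IsRegularRing (p.ResidueField ⊗[p.ResidueField] (p.ResidueField ⊗[A] B)) :=
      h.2 p p.ResidueField inferInstance
    exact IsRegularRing.of_ringEquiv
      (R := p.ResidueField ⊗[p.ResidueField] (p.ResidueField ⊗[A] B))
      (Algebra.TensorProduct.lid p.ResidueField (p.Fiber B)).toRingEquiv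
  -- the prime of the fibre ring under `𝔔`
  let q : PrimeSpectrum (p.Fiber B) :=
    PrimeSpectrum.primesOverOrderIsoFiber A B p ⟨Q, inferInstance, inferInstance⟩
  have hq : q.asIdeal.comap (Algebra.TensorProduct.includeRight : B →ₐ[A] p.Fiber B) = Q := by
    have h1 := PrimeSpectrum.coe_primesOverOrderIsoFiber_symm_apply (R := A) (S := B) p q
    rw [OrderIso.symm_apply_apply] at h1
    exact h1.symm
  have key := isRegularLocalRing_localization_comap_includeRight_iff p hF q.asIdeal
  -- `B_𝔔` is the localization at `𝔮 ∩ B = 𝔔`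
  set r : Ideal B := q.asIdeal.comap (Algebra.TensorProduct.includeRight : B →ₐ[A] p.Fiber B)
  have hM : r.primeCompl = Q.primeCompl := by
    ext x
    change x ∉ r ↔ x ∉ Q
    rw [hq]
  haveI : IsLocalization.AtPrime (Localization.AtPrime Q) r := by
    change IsLocalization r.primeCompl _
    rw [hM]
    exact Localization.isLocalization
  let e : Localization.AtPrime r ≃ₐ[B] Localization.AtPrime Q :=
    IsLocalization.algEquiv r.primeCompl _ _
  rw [← key]
  exact ⟨fun _ => IsRegularLocalRing.of_ringEquiv e.symm.toRingEquiv,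
    fun _ => IsRegularLocalRing.of_ringEquiv e.toRingEquiv⟩

/-- Along a regular (indeed any flat) homomorphism, `dim A_𝔭 ≤ dim B_𝔔` for `𝔔` over `𝔭`.
[cite: Matsumura1987, Thm. 15.1] -/
theorem ringKrullDim_localization_le (h : IsRegularHom A B) (Q : Ideal B) [Q.IsPrime] :
    ringKrullDim (Localization.AtPrime (Q.under A)) ≤ ringKrullDim (Localization.AtPrime Q) :=
  haveI : Module.Flat A B := h.1
  ringKrullDim_localization_under_le_of_flat Q

end IsRegularHom

/-! ## The formal fibres of a local G-ring -/

namespace IsGRing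

variable {A : Type u} [CommRing A] [IsLocalRing A]

/-- **The completion of a Noetherian local G-ring is a regular homomorphism** `A → Â`
(Matsumura §32, p. 256: by definition `A_𝔪 → (A_𝔪)^` is regular, and `A_𝔪 = A`). Transported
from `A_𝔪` to `A` along the isomorphism `A_𝔪 ≅ A` by the local form
`IsRegularHom.completion_of_surjective`. [cite: Matsumura1987, §32 p. 256] -/
theorem isRegularHom_adicCompletion (hA : IsGRing A) :
    IsRegularHom A (AdicCompletion (maximalIdeal A) A) := by
  haveI : IsNoetherianRing A := hA.1
  let L := Localization.AtPrime (maximalIdeal A)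
  have hL : IsRegularHom L (AdicCompletion (maximalIdeal L) L) := hA.2 (maximalIdeal A)
  -- `A ≅ A_𝔪`
  let e : A ≃ₐ[A] L := IsLocalization.atUnits A (maximalIdeal A).primeCompl
    (fun x hx => by
      by_contra h
      exact hx ((IsLocalRing.mem_maximalIdeal x).mpr (mem_nonunits_iff.mpr h)))
  letI : Algebra L A := e.symm.toAlgHom.toRingHom.toAlgebra
  have hsurj : Function.Surjective (algebraMap L A) := e.symm.surjective
  exact IsRegularHom.completion_of_surjective hsurj hL

/-- **EGA IV₂ 7.8.3 (v) for a Noetherian local G-ring, prime by prime**: for a prime `𝔔` of the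
completion `Â` over `𝔭 = 𝔔 ∩ A`, `Â_𝔔` is regular iff `A_𝔭` is, and `dim A_𝔭 ≤ dim Â_𝔔`.
[cite: Matsumura1987, §32 p. 256] -/
theorem isRegularLocalRing_localization_adicCompletion_iff (hA : IsGRing A)
    (Q : Ideal (AdicCompletion (maximalIdeal A) A)) [Q.IsPrime] :
    (IsRegularLocalRing (Localization.AtPrime Q) ↔
        IsRegularLocalRing (Localization.AtPrime (Q.under A))) ∧
      ringKrullDim (Localization.AtPrime (Q.under A)) ≤ ringKrullDim (Localization.AtPrime Q) := by
  haveI : IsNoetherianRing A := hA.1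
  haveI : IsNoetherianRing (AdicCompletion (maximalIdeal A) A) :=
    isNoetherianRing_adicCompletion_maximalIdeal A
  have h := hA.isRegularHom_adicCompletion
  exact ⟨h.isRegularLocalRing_localization_iff Q, h.ringKrullDim_localization_le Q⟩

end IsGRing

end Literature.AlgebraicGeometry.Resolution

end
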